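import Literature.Geometry.Riemannian.KernelNashEntropyPole
import Literature.MeasureTheory.Jensen.EntropyBound
import HarnessLib

/-!
# An a-priori upper bound for the pointed Nash entropy of the conjugate heat kernel
# (Jensen; Bamler 2020a, §5.1)

R. Bamler, *Entropy and heat kernel bounds on a Ricci flow background*, arXiv:2008.07093 (2020a),
§5.1: for the conjugate heat kernel `dν_{x,t;s} = K(x,t;·,s) dg_s` of a Ricci flow on a closed
manifold `Mᵐ` and `τ = t − s > 0`, the pointed Nash entropy is

  `𝒩_{x,t}(τ) = ∫ (−K log K) dg_s − (m/2) log(4πτ) − m/2`      (`∫ K dg_s = 1`),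

(`IsRicciFlow.kernelNashEntropy_eq`), and Jensen's inequality for the concave `u ↦ −u log u` and
the probability density `K` of the finite measure `dg_s` of total mass `|M|_{g_s}` gives
`∫ (−K log K) dg_s ≤ log |M|_{g_s}` (`Literature.MeasureTheory.Jensen`, Gibbs' inequality). Hence
the flow-dependent but otherwise a-priori bound

  `𝒩_{x,t}(τ) ≤ log |M|_{g_{t−τ}} − (m/2) log(4πτ) − m/2`,

which is what makes `𝒩` finite from above before any geometric input (it is the trivial half of
the bootstrap in the proof of Bamler 2020a, Thm. 7.1, and the reason `𝒩 ≤ 0` needs `R ≥ R_min`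
rather than compactness alone).

* `kernelNashEntropy_le_log_measureReal` — the bound above, for a Ricci flow `hflow = (h, cov)`
  on `[a, T]` of a `C^∞` family of Riemannian metrics on a closed connected manifold `M`
  modelled on `ℝᵐ`, `a < s < t ≤ T`, every base point `x`.

Everything is proved; no definitions, no named facts. What is NOT here: the sharp bound `𝒩 ≤ 0`
(Bamler 2020a, Prop. 5.2, from `𝒩 ≤ 𝒲 + m/2`-type monotonicity and `R ≥ R_min`), lower bounds
(`KernelNashEntropyPole.lean`), non-compact `M`.

## References

* R. H. Bamler, *Entropy and heat kernel bounds on a Ricci flow background*, arXiv:2008.07093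
  (2020), §5.1, Def. 5.1, Prop. 5.2; §7, proof of Thm. 7.1. [Bamler2020Entropy]
* P. Topping, *Lectures on the Ricci flow*, LMS Lecture Note Series 325, CUP 2006, §8.3,
  (8.3.7) (the Jensen step). [Topping2006]
-/

noncomputable section

open Bundle Set Function Filter Manifold MeasureTheory Measure TopologicalSpace
open scoped Manifold ContDiff Topology ENNReal NNReal

namespace Literature.Geometry.Riemannian

open Lorentzian Lorentzian.PseudoRiemannianMetric

section UpperBound

variable {m : ℕ} {H : Type*} [TopologicalSpace H]
  {I : ModelWithCorners ℝ (EuclideanSpace ℝ (Fin m)) H} [I.Boundaryless]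
  {M : Type*} [TopologicalSpace M] [ChartedSpace H M] [IsManifold I ∞ M]
  [T2Space M] [CompactSpace M] [SecondCountableTopology M] [MeasurableSpace M] [BorelSpace M]
  [PreconnectedSpace M]
  {h : ℝ → PseudoRiemannianMetric I ∞ (EuclideanSpace ℝ (Fin m)) (TangentSpace I : M → Type _)}
  {cov : ℝ → CovariantDerivative I (EuclideanSpace ℝ (Fin m)) (TangentSpace I : M → Type _)}
  {a T : ℝ} (hflow : IsRicciFlow h cov (Icc a T)) (hh : IsContMDiffFamilyOn ∞ h univ)
  (hR : ∀ r, (h r).IsRiemannian)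

/-- **A-priori upper bound for the pointed Nash entropy of the conjugate heat kernel** (Jensen):
for a Ricci flow on a closed connected manifold `Mᵐ`, `a < s < t ≤ T` and every base point `x`,
`𝒩_{x,t}(t − s) ≤ log |M|_{g_s} − (m/2) log(4π(t − s)) − m/2`. Proof:
`𝒩 = ∫ (−K log K) dg_s − (m/2) log(4π(t − s)) − m/2` (`IsRicciFlow.kernelNashEntropy_eq`) and
`∫ (−K log K) dg_s ≤ log |M|_{g_s}` for the probability density `K = K(x,t;·,s) > 0` of the
finite positive measure `dg_s` (Jensen for `−u log u`,
`Literature.MeasureTheory.Jensen.integral_negMulLog_le_log_measureReal_univ`).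
[cite: Bamler2020Entropy, §5.1, Def. 5.1; §7, proof of Thm. 7.1] -/
theorem kernelNashEntropy_le_log_measureReal {s t : ℝ} (has : a < s) (hst : s < t) (htT : t ≤ T)
    (x : M) :
    pointedNashEntropy h (fun r y ↦ hflow.heatKernelFn hh hR t x (y, r)) m t s ≤
      Real.log ((h s).riemVolume.real univ) - (m : ℝ) / 2 * Real.log (4 * Real.pi * (t - s)) -
        (m : ℝ) / 2 := by
  have ht : t ∈ Ioc a T := ⟨has.trans hst, htT⟩
  have hs : s ∈ Ioo a t := ⟨has, hst⟩
  haveI : IsFiniteMeasure (h s).riemVolume := ⟨(h s).riemVolume_univ_lt_top⟩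
  haveI : Nonempty M := ⟨x⟩
  haveI : NeZero (h s).riemVolume :=
    ⟨Measure.measure_univ_pos.1 (PseudoRiemannianMetric.riemVolume_univ_pos (hR s))⟩
  set K : M → ℝ := fun y ↦ hflow.heatKernelFn hh hR t x (y, s) with hK
  have hKc : Continuous K := hflow.continuous_heatKernelFn_slice hh hR ht x hs
  have hKpos : ∀ y, 0 < K y := fun y ↦ hflow.heatKernelFn_pos hh hR ht x ⟨mem_univ _, hs⟩
  have hKi : Integrable K (h s).riemVolume :=
    hKc.integrable_of_hasCompactSupport (HasCompactSupport.of_compactSpace _)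
  have hΛi : Integrable (fun y ↦ Real.negMulLog (K y)) (h s).riemVolume :=
    (Real.continuous_negMulLog.comp hKc).integrable_of_hasCompactSupport
      (HasCompactSupport.of_compactSpace _)
  have hmass : ∫ y, K y ∂(h s).riemVolume = 1 := hflow.integral_heatKernelFn_eq_one hh hR ht x hs
  -- Jensen: `∫ (−K log K) dg_s ≤ log |M|_{g_s}`
  have hJ : ∫ y, Real.negMulLog (K y) ∂(h s).riemVolume ≤ Real.log ((h s).riemVolume.real univ) :=
    Literature.MeasureTheory.Jensen.integral_negMulLog_le_log_measureReal_univ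
      (Eventually.of_forall fun y ↦ (hKpos y).le) hKi hmass hΛi
  rw [hflow.kernelNashEntropy_eq hh hR ht x hs]
  simp only [Real.negMulLog, neg_mul, hK] at hJ
  linarith

end UpperBound

end Literature.Geometry.Riemannian

end
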